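import Summits.ABC.IUTFork.Thm311RealInd1UnitsBaseLineMover
import HarnessLib

/-!
# The unit-group shear at `v₇ = (√7)` of `ℚ(√7)`, VI: THE KERNEL OF `L₇` IS TORSION, AND THE
# TRANSPORTED MAP ON THE LOG-BALL — part 1 of row «R9f-REALISATION»

Record file (D-0012) of the abc-iut cell (TEAM R, lead seat abc-iut-c312-14 = R1, gen 10; row
«R9f-REALISATION», claimed plan/C312-TEAMS.md 2026-08-27T02:04:30Z); sequel of
`Thm311RealInd1UnitsBaseLineMover.lean` (p476108).  Part 2, `Thm311RealInd1UnitsRealisation.lean`,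
proves THE UNCONDITIONAL REALISATION THEOREM at `v₇` on top of this file.
TAKES NO SIDE on [IUTchIII] Cor. 3.12.

CONTENT.  The two kernel facts on which the realisation of an ABSTRACT `φ ∈ Aut_top(G_{v₇})`
through the analytic logarithm rests:

* **`ker L₇ = torsion`** — `exists_pow_eq_one_of_unitLog_xval_eq_zero`: a unit of `𝒪_{v₇}` whose
  analytic log vanishes has finite order.  Ingredients: value-group discreteness at `K₇`
  (`norm_le_omega_of_norm_lt_one`: `‖y‖ < 1 ⟹ ‖y‖ ≤ ‖Ω‖`, coordinatewise from `norm_decomp` and the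
  `ℚ₇` parity lemma `Padic.norm_lt_pow_iff_norm_le_pow_sub_one`), `exists_pow_isPrincipal`
  (every norm-one element has a principal power, compactness), `unitLog_eq_inv_mul_logSeries`, and
  injectivity of the log series on `1 + B(0, ‖Ω‖)` (`logSeries_injOn`,
  `eq_one_of_isPrincipal_of_logSeries_eq_zero`).  [cite: NeukirchANT1999, Ch. II (5.4)–(5.5)]

* **the units transport preserves `ker L₇`** — `unitLog_xval_liftUnits_eq_zero` /
  **`unitLog_xval_liftUnits_congr`**: torsion is group-theoretic, so `liftUnits v₇ φ` (THE
  [AbsTopIII] Prop. 3.2 (iv) transport, c312-1's `Thm311RealInd1Strip`) carries log-equal units to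
  log-equal units — the well-definedness of the transported map on log values.
  [cite: MochizukiAbsTopIII2015, Proposition 3.2 (iv) p.72]

* **`psiBall φ`** — the transported map on the tame log-ball `log₇(𝒪^×) = B(0, ‖Ω‖)`
  (`logUnits_eq_ball`): `z ↦ log₇(x(liftUnits v₇ φ (exp_B z)))`, with its defining property on log
  values (`psiBall_unitLog_xval`), additivity (`psiBall_add`), the `7^k`-scaling law
  (`psiBall_seven_pow_mul`) and the ball-level inverse law (`psiBall_symm_psiBall`) — the data from
  which part 2 builds the bicontinuous realisation of `stripMulAut v₇ φ` for EVERY `φ`.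

HONEST SCOPE: statements at the single tame quadratically ramified place `v₇` over THE analytic
logarithm `L₇`; fact-free (no new `Prop` facts, D-0067); consumed BY NAME: the UnitsShear chain
(R1 g7–g9), `liftUnits` (c312-1), abc-iut-S1's `unitLog`/`logSeries` kit.  Nothing here asserts or
refutes [IUTchIII] Cor. 3.12.  [claim: Mochizuki2012, status: disputed] for every [IUTchIII]
locution.  typed ≠ proved.
-/

set_option autoImplicit false

noncomputable section

namespace Summit.ABC.IUTFork.Thm311.Real.UnitsShear

open Literature.IUT.LogVolume Literature.NumberTheory.NumberFields
open NumberField IsDedekindDomain Metric IsUltrametricDist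
open Summit.ABC.IUTFork.RamifiedMover
open Summit.ABC.IUTFork.Thm311.Real

/-! ## 1. Value-group discreteness at `K₇` and the kernel of the logarithm -/

/-- `7 ≠ 0` in `K₇` (its norm is `‖Ω‖² > 0`). [folklore] -/
theorem seven_ne_zero_K7 : (7 : K7) ≠ 0 := by
  intro h0
  have h := norm_seven_K7
  rw [h0, norm_zero] at h
  obtain ⟨hp, -⟩ := norm_omega_pos_lt_one
  nlinarith

/-- Value-group discreteness in `ℚ₇`: `‖c‖ < 1` forces `‖c‖ ≤ 7⁻¹`. [folklore] -/
theorem norm_q7_le_inv_of_lt_one {c : ℚ_[7]} (hc : ‖c‖ < 1) : ‖c‖ ≤ ((7 : ℕ) : ℝ)⁻¹ := by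
  have h := (Padic.norm_lt_pow_iff_norm_le_pow_sub_one c 0).mp (by rwa [zpow_zero])
  rwa [show (0 : ℤ) - 1 = -1 by norm_num, zpow_neg_one] at h

/-- Value-group discreteness in `ℚ₇`: `‖c‖ < 7` forces `‖c‖ ≤ 1`. [folklore] -/
theorem norm_q7_le_one_of_lt_seven {c : ℚ_[7]} (hc : ‖c‖ < ((7 : ℕ) : ℝ)) : ‖c‖ ≤ 1 := by
  have h1 : ‖c‖ < ((7 : ℕ) : ℝ) ^ (1 : ℤ) := by rwa [zpow_one]
  have h := (Padic.norm_lt_pow_iff_norm_le_pow_sub_one c 1).mp h1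
  rwa [show (1 : ℤ) - 1 = 0 by norm_num, zpow_zero] at h

/-- **Value-group discreteness at `K₇`**: `‖y‖ < 1` forces `‖y‖ ≤ ‖Ω‖` (the value group is `‖Ω‖^ℤ`;
coordinatewise via `norm_decomp`). [folklore] -/
theorem norm_le_omega_of_norm_lt_one {y : K7} (hy : ‖y‖ < 1) : ‖y‖ ≤ ‖Omega‖ := by
  obtain ⟨h0, h1⟩ := norm_omega_pos_lt_one
  have hsq := norm_omega_sq
  rw [norm_decomp] at hy ⊢
  obtain ⟨ha, hb⟩ := max_lt_iff.mp hy
  refine max_le ?_ ?_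
  · have h := norm_q7_le_inv_of_lt_one ha
    rw [← hsq] at h
    nlinarith [norm_nonneg (bs7.repr y 0), mul_lt_mul_of_pos_left h1 h0]
  · have hble : ‖bs7.repr y 1‖ ≤ 1 := by
      rcases lt_or_ge ‖bs7.repr y 1‖ ((7 : ℕ) : ℝ) with hlt | hge
      · exact norm_q7_le_one_of_lt_seven hlt
      · exfalso
        have hlt1 : ((7 : ℕ) : ℝ) * ‖Omega‖ < 1 :=
          lt_of_le_of_lt (mul_le_mul_of_nonneg_right hge h0.le) hb
        have h71 : ((7 : ℕ) : ℝ) * ‖Omega‖ ^ 2 = 1 := by rw [hsq]; norm_num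
        nlinarith [mul_lt_mul_of_pos_right hlt1 h0]
    calc ‖bs7.repr y 1‖ * ‖Omega‖ ≤ 1 * ‖Omega‖ := mul_le_mul_of_nonneg_right hble h0.le
      _ = ‖Omega‖ := one_mul _

/-- A principal unit of `K₇` lies at distance `≤ ‖Ω‖` from `1` (discreteness applied to `1 − y`).
[folklore] -/
theorem norm_one_sub_le_omega_of_isPrincipal {y : K7} (hy : IsPrincipal y) :
    ‖1 - y‖ ≤ ‖Omega‖ :=
  norm_le_omega_of_norm_lt_one hy

/-- **A principal unit with vanishing log series is `1`** (injectivity of `logSeries` on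
`1 + B(0, ‖Ω‖)`). [cite: NeukirchANT1999, Ch. II (5.5)] -/
theorem eq_one_of_isPrincipal_of_logSeries_eq_zero {y : K7} (hy : IsPrincipal y)
    (h : logSeries y = 0) : y = 1 := by
  refine logSeries_injOn 7 K7 theta_rad1_lt_one ?_ ?_ ?_
  · exact norm_one_sub_le_omega_of_isPrincipal hy
  · show ‖(1 : K7) - 1‖ ≤ ‖Omega‖
    rw [sub_self, norm_zero]
    exact norm_omega_pos_lt_one.1.le
  · rw [h, logSeries_one]

/-- **`ker L₇ ⊆ torsion`**: a unit of `𝒪_{v₇}` whose analytic log vanishes has finite order (some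
power is a principal unit with zero log series, hence `1`). [cite: NeukirchANT1999, Ch. II (5.5)] -/
theorem exists_pow_eq_one_of_unitLog_xval_eq_zero {u : (↥(v7.adicCompletionIntegers ↥F7))ˣ}
    (h : unitLog (xval u) = 0) : ∃ m : ℕ, 0 < m ∧ u ^ m = 1 := by
  obtain ⟨m, hm, hP⟩ := exists_pow_isPrincipal (K := K7) (norm_xval u)
  refine ⟨m, hm, ?_⟩
  have hlog := unitLog_eq_inv_mul_logSeries (p := 7) hm hP
  rw [h] at hlog
  haveI : CharZero K7 := charZero_of_injective_algebraMap (algebraMap ℚ_[7] K7).injective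
  have hm0 : ((m : ℕ) : K7) ≠ 0 := Nat.cast_ne_zero.mpr hm.ne'
  have hser : logSeries ((xval u) ^ m) = 0 :=
    (mul_eq_zero.mp hlog.symm).resolve_left (inv_ne_zero hm0)
  have hP1 : (xval u) ^ m = 1 := eq_one_of_isPrincipal_of_logSeries_eq_zero hP hser
  apply xval_injective
  rw [xval_pow, hP1, xval_one]

/-! ## 2. The transport preserves the kernel of `L₇` (torsion is group-theoretic) -/

/-- **The units transport preserves `ker L₇`**: torsion is preserved by any group automorphism, and
`ker L₇ = torsion`. [cite: MochizukiAbsTopIII2015, Proposition 3.2 (iv) p.72] -/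
theorem unitLog_xval_liftUnits_eq_zero (φ : Gal v7 ≃ₜ* Gal v7)
    {u : (↥(v7.adicCompletionIntegers ↥F7))ˣ} (h : unitLog (xval u) = 0) :
    unitLog (xval (liftUnits v7 φ u)) = 0 := by
  obtain ⟨m, hm, hu⟩ := exists_pow_eq_one_of_unitLog_xval_eq_zero h
  have hlift : (liftUnits v7 φ u) ^ m = 1 := by rw [← map_pow, hu, map_one]
  have hx : (xval (liftUnits v7 φ u)) ^ m = 1 := by rw [← xval_pow, hlift, xval_one]
  exact unitLog_eq_zero_of_pow_eq_one 7 hm hx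

/-- **Log-equal units have log-equal transports** — the well-definedness of the realisation on the
log-lattice. [cite: MochizukiAbsTopIII2015, Proposition 3.2 (iv) p.72] -/
theorem unitLog_xval_liftUnits_congr (φ : Gal v7 ≃ₜ* Gal v7)
    {u w : (↥(v7.adicCompletionIntegers ↥F7))ˣ}
    (h : unitLog (xval u) = unitLog (xval w)) :
    unitLog (xval (liftUnits v7 φ u)) = unitLog (xval (liftUnits v7 φ w)) := by
  have hinv : ‖(xval w)⁻¹‖ = 1 := by rw [norm_inv, norm_xval]; norm_num
  have hdiff : unitLog (xval (u * w⁻¹)) = 0 := by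
    rw [xval_mul, xval_inv, unitLog_mul (p := 7) (norm_xval u) hinv,
      unitLog_inv (p := 7) (norm_xval w), h, add_neg_cancel]
  have h2 := unitLog_xval_liftUnits_eq_zero φ hdiff
  have hcomp : liftUnits v7 φ u = liftUnits v7 φ (u * w⁻¹) * liftUnits v7 φ w := by
    rw [← map_mul, inv_mul_cancel_right]
  rw [hcomp, xval_mul, unitLog_mul (p := 7) (norm_xval _) (norm_xval _), h2, zero_add]

/-! ## 3. The transported map on the log-ball `B(0, ‖Ω‖) = log₇(𝒪^×)` -/

/-- **The transported map on the log-ball**: `z ↦ log₇(x(liftUnits v₇ φ (exp_B z)))` (junk value `0`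
off the ball) — the `φ`-transport of the tame log-lattice read through `exp_B`/`log₇`.
[cite: MochizukiAbsTopIII2015, Proposition 3.2 (iv) p.72] -/
def psiBall (φ : Gal v7 ≃ₜ* Gal v7) (z : K7) : K7 :=
  if h : ‖z‖ ≤ ‖Omega‖ then unitLog (xval (liftUnits v7 φ (unitOf (norm_expB h)))) else 0

/-- `psiBall` unfolded. [folklore] -/
theorem psiBall_apply (φ : Gal v7 ≃ₜ* Gal v7) (z : K7) :
    psiBall φ z =
      if h : ‖z‖ ≤ ‖Omega‖ then unitLog (xval (liftUnits v7 φ (unitOf (norm_expB h)))) else 0 :=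
  rfl

/-- The transported map lands in the log-ball (`log₇` of a unit). [folklore] -/
theorem norm_psiBall_le (φ : Gal v7 ≃ₜ* Gal v7) (z : K7) : ‖psiBall φ z‖ ≤ ‖Omega‖ := by
  rw [psiBall_apply]
  split_ifs with h
  · exact norm_unitLog_xval _
  · rw [norm_zero]
    exact norm_omega_pos_lt_one.1.le

/-- **The defining property on log values**: `psiBall φ (L₇-value of u) = L₇-value of (liftUnits v₇ φ u)`
for EVERY unit `u` (well-defined by `unitLog_xval_liftUnits_congr`).
[cite: MochizukiAbsTopIII2015, Proposition 3.2 (iv) p.72] -/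
theorem psiBall_unitLog_xval (φ : Gal v7 ≃ₜ* Gal v7) (u : (↥(v7.adicCompletionIntegers ↥F7))ˣ) :
    psiBall φ (unitLog (xval u)) = unitLog (xval (liftUnits v7 φ u)) := by
  have hz : ‖unitLog (xval u)‖ ≤ ‖Omega‖ := norm_unitLog_xval u
  rw [psiBall_apply, dif_pos hz]
  refine unitLog_xval_liftUnits_congr φ ?_
  rw [xval_unitOf, unitLog_expB hz]

/-- `psiBall φ 0 = 0`. [folklore] -/
theorem psiBall_zero (φ : Gal v7 ≃ₜ* Gal v7) : psiBall φ 0 = 0 := by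
  have h0 : ‖(0 : K7)‖ ≤ ‖Omega‖ := by
    rw [norm_zero]
    exact norm_omega_pos_lt_one.1.le
  rw [psiBall_apply, dif_pos h0]
  have hu : unitOf (norm_expB h0) = 1 := by
    apply xval_injective
    rw [xval_unitOf, expB_zero, xval_one]
  rw [hu, map_one, xval_one, unitLog_one 7]

/-- **Additivity on the log-ball** (`exp_B` is a homomorphism there, the transport is multiplicative,
`log₇` is additive on units). [folklore] -/
theorem psiBall_add (φ : Gal v7 ≃ₜ* Gal v7) {z w : K7} (hz : ‖z‖ ≤ ‖Omega‖)
    (hw : ‖w‖ ≤ ‖Omega‖) : psiBall φ (z + w) = psiBall φ z + psiBall φ w := by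
  have hzw : ‖z + w‖ ≤ ‖Omega‖ := (norm_add_le_max z w).trans (max_le hz hw)
  have hu : unitOf (norm_expB hzw) = unitOf (norm_expB hz) * unitOf (norm_expB hw) := by
    apply xval_injective
    simp only [xval_mul, xval_unitOf]
    exact expB_add hz hw
  rw [psiBall_apply, dif_pos hzw, psiBall_apply, dif_pos hz, psiBall_apply, dif_pos hw, hu,
    map_mul, xval_mul, unitLog_mul (p := 7) (norm_xval _) (norm_xval _)]

/-- `ℕ`-scaling on the log-ball. [folklore] -/
theorem psiBall_nsmul (φ : Gal v7 ≃ₜ* Gal v7) (n : ℕ) {z : K7} (hz : ‖z‖ ≤ ‖Omega‖) :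
    psiBall φ (n • z) = n • psiBall φ z := by
  induction n with
  | zero => rw [zero_nsmul, zero_nsmul, psiBall_zero]
  | succ n ih =>
    have hnz : ‖n • z‖ ≤ ‖Omega‖ := (IsUltrametricDist.norm_nsmul_le z n).trans hz
    rw [succ_nsmul, succ_nsmul, psiBall_add φ hnz hz, ih]

/-- `7^k`-scaling on the log-ball (the extension law). [folklore] -/
theorem psiBall_seven_pow_mul (φ : Gal v7 ≃ₜ* Gal v7) (k : ℕ) {z : K7} (hz : ‖z‖ ≤ ‖Omega‖) :
    psiBall φ ((7 : K7) ^ k * z) = (7 : K7) ^ k * psiBall φ z := by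
  have h1 : (7 : K7) ^ k * z = (7 ^ k : ℕ) • z := by
    rw [nsmul_eq_mul]
    push_cast
    ring
  have h2 : (7 : K7) ^ k * psiBall φ z = (7 ^ k : ℕ) • psiBall φ z := by
    rw [nsmul_eq_mul]
    push_cast
    ring
  rw [h1, h2, psiBall_nsmul φ _ hz]

/-- **The ball-level inverse law**: the transport at `φ⁻¹` inverts the transport at `φ` on the
log-ball. [folklore] -/
theorem psiBall_symm_psiBall (φ : Gal v7 ≃ₜ* Gal v7) {z : K7} (hz : ‖z‖ ≤ ‖Omega‖) :
    psiBall φ.symm (psiBall φ z) = z := by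
  rw [psiBall_apply φ z, dif_pos hz,
    psiBall_unitLog_xval φ.symm (liftUnits v7 φ (unitOf (norm_expB hz)))]
  have hcancel : liftUnits v7 φ.symm (liftUnits v7 φ (unitOf (norm_expB hz))) =
      unitOf (norm_expB hz) := by
    rw [liftUnits_apply, liftUnits_apply, liftUnitsFun_symm_apply]
  rw [hcancel, xval_unitOf, unitLog_expB hz]

end Summit.ABC.IUTFork.Thm311.Real.UnitsShear

end
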